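import Summits.AtomisticToContinuum.HydrodynamicLimit.Theses.ImplosionDichotomy
import Literature.MathematicalPhysics.KineticTheory.HardSphereEulerProofs

/-!
# The κ-ladder of `PolynomialCompression`, and what a disproof would prove

Negative-side structure for the crux `ImplosionDichotomy.PolynomialCompression` (stmt-AtomisticToContinuum-12587),
from the standing disprover's `Cruxes/PolynomialCompression/Disproof.lean` §1, §5, §6 (cycles 1–3), landed so that
line skeletons and sibling seats can import it:
* `PolynomialCompressionAt κ` — the crux at a GIVEN exponent; `polynomialCompression_iff_exists_at` (definitional);
  `polynomialCompressionAt_anti` — ANTITONE in `κ` (a smaller exponent is a weaker claim), so WLOG `κ` is small;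
* `polynomialCompressionAt_of_denseExcursion` — `DenseExcursion → PolynomialCompressionAt κ` for EVERY `κ < 3`, and
  `not_polynomialCompressionAt_of_not_denseExcursion` — `¬DenseExcursion → ¬PolynomialCompressionAt κ` for `κ ≥ 3`:
  the rank-2 crux `DenseExcursion` sits EXACTLY at the rung `κ = 3` and the crux (`∃ κ > 0`) is the bottom of the
  ladder (`not_denseExcursion_of_not_polynomialCompression`; positively, `DenseExcursion → PolynomialCompression`
  with `κ = 2` is the planner's "refuter ladder lemma" — a positive glue between route items, left to provers);
* `tendstoHydroFieldsAt_zero_of_one_flow` — the `t = 0` tie is FLOW-INDEPENDENT (`Φ_0 = id` a.e., the local Gibbs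
  law is the flow-free `localGibbsMeasure` for every flow: `localGibbsLaw_preimage_flow_zero`), so the one-flow tie
  of `DiluteSelfConsistency` and the all-flows admissibility of the negative items coincide;
* `packingBound_of_not_polynomialCompression` — A DISPROOF OF THE CRUX PROVES THE OPEN RANK-3 CRUX
  `DiluteSelfConsistency` (stmt-3091, shared by 13 routes): `¬PC` at `κ = 1` is a σ-uniform density bound
  `ρ < σ⁻¹`, i.e. packing `< σ² → 0`; the theorem's conclusion is `DiluteSelfConsistency` UNFOLDED VERBATIM (so
  `fun h => packingBound_of_not_polynomialCompression h : ¬PolynomialCompression → DiluteSelfConsistency` type-checks,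
  and with the route's proved assembly `closes` a disproof plus `HydroLimitInBand` gives the sub-problem — positive
  conclusions, left to provers). This is WHY THE CRUX RESISTS cheap refutation: its negation is an a-priori `L∞`
  bound at the first singularity of 3-D compressible Euler for all smooth positive data.
refuter-cdisprove-stmt-AtomisticToContinuum-12587-g3-0.
-/

noncomputable section

namespace Summit.AtomisticToContinuum.HydrodynamicLimit.Theorems

open MeasureTheory Filter Set Topology
open scoped ENNReal
open Literature.MathematicalPhysics.KineticTheory Literature.Analysis.FluidPDE
open Summit.AtomisticToContinuum.HydrodynamicLimit.Theses.ImplosionDichotomy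
  (PolynomialCompression DenseExcursion DiluteSelfConsistency)

/-- The crux `PolynomialCompression` at a GIVEN exponent `κ` (the crux is `∃ κ > 0, PolynomialCompressionAt κ`;
body verbatim otherwise). -/
def PolynomialCompressionAt (κ : ℝ) : Prop :=
  ∃ (a₀ θ₀ : Literature.MathematicalPhysics.KineticTheory.T3 → ℝ) (u₀ : Literature.MathematicalPhysics.KineticTheory.T3 → Literature.MathematicalPhysics.KineticTheory.V3), Continuous a₀ ∧ Continuous θ₀ ∧ Continuous u₀ ∧ (∀ x, 0 < a₀ x) ∧ (∀ x, 0 < θ₀ x) ∧ ∀ σ₀ : ℝ, 0 < σ₀ → ∃ σ : ℝ, 0 < σ ∧ σ < σ₀ ∧ ∃ (T : ℝ) (ρ θ : ℝ → Literature.MathematicalPhysics.KineticTheory.T3 → ℝ) (u : ℝ → Literature.MathematicalPhysics.KineticTheory.T3 → Literature.MathematicalPhysics.KineticTheory.V3), Literature.MathematicalPhysics.KineticTheory.IsHardSphereEulerSolution σ T ρ u θ ∧ (∀ Φ : (N : ℕ) → Literature.Analysis.FluidPDE.HardSphereFlow (Literature.Analysis.FluidPDE.Torus.geometry (Fin 3))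 (Literature.MathematicalPhysics.KineticTheory.hsDiameter σ N) (N + 1), Literature.MathematicalPhysics.KineticTheory.TendstoHydroFieldsAt (fun N => Literature.MathematicalPhysics.KineticTheory.localGibbsLaw σ a₀ u₀ θ₀ N (Φ N)) Φ ρ u θ 0) ∧ ∃ t ∈ Set.Ico 0 T, ∃ x, σ ^ (-κ) ≤ ρ t x

namespace PolynomialCompressionAt

/-- A family of hard-sphere flows, one per particle number, at reduced density `σ`. -/
abbrev Flows (σ : ℝ) :=
  (N : ℕ) → HardSphereFlow (Torus.geometry (Fin 3)) (hsDiameter σ N) (N + 1)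

/-- The common `∃∀∃` shape of the route's negative-side items, with the density target `good σ (ρ t x)`:
`PolynomialCompressionAt κ = Reaches (σ^(-κ) ≤ ·)`, `DenseExcursion = ∃ η > 0, Reaches (η ≤ · σ³)`. -/
def Reaches (good : ℝ → ℝ → Prop) : Prop :=
  ∃ (a₀ θ₀ : T3 → ℝ) (u₀ : T3 → V3), Continuous a₀ ∧ Continuous θ₀ ∧ Continuous u₀ ∧
    (∀ x, 0 < a₀ x) ∧ (∀ x, 0 < θ₀ x) ∧ ∀ σ₀ : ℝ, 0 < σ₀ → ∃ σ : ℝ, 0 < σ ∧ σ < σ₀ ∧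
      ∃ (T : ℝ) (ρ θ : ℝ → T3 → ℝ) (u : ℝ → T3 → V3), IsHardSphereEulerSolution σ T ρ u θ ∧
        (∀ Φ : Flows σ, TendstoHydroFieldsAt (fun N => localGibbsLaw σ a₀ u₀ θ₀ N (Φ N)) Φ ρ u θ 0) ∧
        ∃ t ∈ Ico 0 T, ∃ x, good σ (ρ t x)

/-- `PolynomialCompressionAt κ` is `Reaches (σ^(-κ) ≤ ·)` (definitional). [folklore] -/
theorem iff_reaches (κ : ℝ) : PolynomialCompressionAt κ ↔ Reaches fun σ r => σ ^ (-κ) ≤ r :=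
  Iff.rfl

/-- `DenseExcursion` is `∃ η > 0, Reaches (η ≤ · σ³)` (definitional). [folklore] -/
theorem denseExcursion_iff_reaches :
    DenseExcursion ↔ ∃ η : ℝ, 0 < η ∧ Reaches fun σ r => η ≤ r * σ ^ 3 :=
  Iff.rfl

/-- Monotonicity of the common shape in the target, the implication being needed only for `0 < σ < σ₁`
(shrink `σ₀` to `min σ₀ σ₁`). [folklore] -/
theorem Reaches.mono {g g' : ℝ → ℝ → Prop} {σ₁ : ℝ} (hσ₁ : 0 < σ₁)
    (h : ∀ σ r, 0 < σ → σ < σ₁ → g σ r → g' σ r) : Reaches g → Reaches g' := by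
  rintro ⟨a₀, θ₀, u₀, ha, hθ, hu, ha0, hθ0, H⟩
  refine ⟨a₀, θ₀, u₀, ha, hθ, hu, ha0, hθ0, fun σ₀ hσ₀ => ?_⟩
  obtain ⟨σ, hσ, hσlt, T, ρ, θ, u, hE, hA, t, ht, x, hx⟩ := H (min σ₀ σ₁) (lt_min hσ₀ hσ₁)
  exact ⟨σ, hσ, lt_of_lt_of_le hσlt (min_le_left _ _), T, ρ, θ, u, hE, hA, t, ht, x,
    h σ _ hσ (lt_of_lt_of_le hσlt (min_le_right _ _)) hx⟩

/-- `σ^(3-κ) = σ³ · σ^(-κ)` (`rpow` bookkeeping). [folklore] -/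
theorem rpow_three_sub (σ κ : ℝ) (hσ : 0 < σ) : σ ^ (3 - κ) = σ ^ (3 : ℕ) * σ ^ (-κ) := by
  have e : (3 : ℝ) - κ = ((3 : ℕ) : ℝ) + -κ := by push_cast; ring
  rw [e, Real.rpow_add hσ, Real.rpow_natCast]

/-- **The `t = 0` tie is flow-independent**: the LLN tie through ONE flow family gives it through EVERY flow family
(`Φ_0 = id` Liouville-a.e. on the good set and the local Gibbs law is the flow-free `localGibbsMeasure` for every
flow, `localGibbsLaw_preimage_flow_zero`; no hypothesis on `σ` or the profiles). [folklore] -/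
theorem tendstoHydroFieldsAt_zero_of_one_flow {σ : ℝ} {a₀ θ₀ : T3 → ℝ} {u₀ : T3 → V3}
    {ρ θ : ℝ → T3 → ℝ} {u : ℝ → T3 → V3} (Φ Ψ : Flows σ)
    (h : TendstoHydroFieldsAt (fun N => localGibbsLaw σ a₀ u₀ θ₀ N (Φ N)) Φ ρ u θ 0) :
    TendstoHydroFieldsAt (fun N => localGibbsLaw σ a₀ u₀ θ₀ N (Ψ N)) Ψ ρ u θ 0 := by
  have key : ∀ (Ξ : Flows σ) (N : ℕ) (p : Config (N + 1) (Fin 3) T3 → Prop),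
      localGibbsLaw σ a₀ u₀ θ₀ N (Ξ N) {z | p ((Ξ N).flow 0 z)} = localGibbsMeasure σ a₀ u₀ θ₀ N {z | p z} :=
    fun Ξ N p => localGibbsLaw_preimage_flow_zero σ a₀ u₀ θ₀ N (Ξ N) {z | p z}
  intro χ hχ δ hδ
  obtain ⟨h1, h2, h3⟩ := h χ hχ δ hδ
  refine ⟨?_, ?_, ?_⟩
  · refine h1.congr fun N => ?_
    exact (key Φ N fun z => δ < |empiricalDensityField z χ - ∫ x, χ x * ρ 0 x|).trans
      (key Ψ N fun z => δ < |empiricalDensityField z χ - ∫ x, χ x * ρ 0 x|).symm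
  · refine h2.congr fun N => ?_
    exact (key Φ N fun z => δ < ‖empiricalMomentumField z χ - ∫ x, (χ x * ρ 0 x) • u 0 x‖).trans
      (key Ψ N fun z => δ < ‖empiricalMomentumField z χ - ∫ x, (χ x * ρ 0 x) • u 0 x‖).symm
  · refine h3.congr fun N => ?_
    exact (key Φ N fun z => δ < |empiricalEnergyField z χ -
        ∫ x, χ x * totalEnergyDensity (ρ 0 x) (u 0 x) (θ 0 x)|).trans
      (key Ψ N fun z => δ < |empiricalEnergyField z χ -
        ∫ x, χ x * totalEnergyDensity (ρ 0 x) (u 0 x) (θ 0 x)|).symm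

end PolynomialCompressionAt

open PolynomialCompressionAt

/-- The crux, unfolded: `PolynomialCompression ↔ ∃ κ > 0, PolynomialCompressionAt κ` (definitional). [folklore] -/
theorem polynomialCompression_iff_exists_at :
    PolynomialCompression ↔ ∃ κ : ℝ, 0 < κ ∧ PolynomialCompressionAt κ :=
  Iff.rfl

/-- **Antitone in `κ`**: a smaller exponent is a weaker claim (`σ < 1`), so WLOG `κ` is as small as convenient.
[folklore] -/
theorem polynomialCompressionAt_anti {κ κ' : ℝ} (hκ : κ' ≤ κ) :
    PolynomialCompressionAt κ → PolynomialCompressionAt κ' :=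
  Reaches.mono one_pos fun σ r hσ hσ1 (hr : σ ^ (-κ) ≤ r) =>
    (Real.rpow_le_rpow_of_exponent_ge hσ hσ1.le (neg_le_neg hκ)).trans hr

/-- **Lower rungs**: `DenseExcursion → PolynomialCompressionAt κ` for EVERY `κ < 3` (`η ≤ ρσ³` and `σ^(3-κ) < η` for
`σ < η^{1/(3-κ)}` give `σ^(-κ) ≤ ρ`). [folklore] -/
theorem polynomialCompressionAt_of_denseExcursion {κ : ℝ} (hκ : κ < 3) (h : DenseExcursion) :
    PolynomialCompressionAt κ := by
  obtain ⟨η, hη, hR⟩ := denseExcursion_iff_reaches.1 h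
  have h3 : 0 < 3 - κ := by linarith
  refine Reaches.mono (σ₁ := min 1 (η ^ (3 - κ)⁻¹)) (lt_min one_pos (Real.rpow_pos_of_pos hη _))
    (fun σ r hσ hσlt (hr : η ≤ r * σ ^ 3) => ?_) hR
  have hση : σ < η ^ (3 - κ)⁻¹ := lt_of_lt_of_le hσlt (min_le_right _ _)
  have hσ3 : 0 < σ ^ 3 := pow_pos hσ 3
  have hpow : σ ^ (3 - κ) < η := by
    calc σ ^ (3 - κ) < (η ^ (3 - κ)⁻¹) ^ (3 - κ) := Real.rpow_lt_rpow hσ.le hση h3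
      _ = η := by rw [← Real.rpow_mul hη.le, inv_mul_cancel₀ h3.ne', Real.rpow_one]
  rw [rpow_three_sub σ κ hσ] at hpow
  have key : σ ^ (-κ) * σ ^ 3 < r * σ ^ 3 := by
    rw [mul_comm]; exact hpow.trans_le hr
  exact (lt_of_mul_lt_mul_right key hσ3.le).le

/-- **Upper rung** (negative form): for `κ ≥ 3`, `¬DenseExcursion → ¬PolynomialCompressionAt κ` (with `η = 1`:
`1 ≤ σ^(3-κ) = σ³σ^(-κ) ≤ ρσ³` for `σ < 1`); so `DenseExcursion` is exactly the `κ = 3` endpoint of the ladder.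
[folklore] -/
theorem not_polynomialCompressionAt_of_not_denseExcursion {κ : ℝ} (hκ : 3 ≤ κ) (hDE : ¬ DenseExcursion) :
    ¬ PolynomialCompressionAt κ := by
  intro h
  refine hDE (denseExcursion_iff_reaches.2 ⟨1, one_pos, Reaches.mono one_pos
    (fun σ r hσ hσ1 (hr : σ ^ (-κ) ≤ r) => ?_) h⟩)
  have h1 : (1 : ℝ) ≤ σ ^ (3 - κ) := Real.one_le_rpow_of_pos_of_le_one_of_nonpos hσ hσ1.le (by linarith)
  rw [rpow_three_sub σ κ hσ] at h1
  calc (1 : ℝ) ≤ σ ^ (3 : ℕ) * σ ^ (-κ) := h1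
    _ ≤ σ ^ 3 * r := mul_le_mul_of_nonneg_left hr (pow_nonneg hσ.le 3)
    _ = r * σ ^ 3 := mul_comm _ _

/-- **Bottom of the ladder**: a disproof of the crux also refutes `DenseExcursion` (rank 2) — `DenseExcursion` gives
`PolynomialCompressionAt 2`. [folklore] -/
theorem not_denseExcursion_of_not_polynomialCompression (h : ¬ PolynomialCompression) : ¬ DenseExcursion :=
  fun hDE => h (polynomialCompression_iff_exists_at.2
    ⟨2, two_pos, polynomialCompressionAt_of_denseExcursion (by norm_num) hDE⟩)

/-- **What a disproof must deliver** (`push_neg` through the crux): for EVERY `κ > 0` and EVERY continuous positive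
profile triple, a threshold `σ₀` below which EVERY admissible classical hard-sphere-Euler solution obeys
`ρ < σ^(-κ)` on its whole interval of existence — a σ-uniform a-priori `L∞` density bound at the first singularity
of 3-D compressible Euler for arbitrary smooth data. [folklore] -/
theorem not_polynomialCompression_iff :
    ¬ PolynomialCompression ↔
      ∀ κ : ℝ, 0 < κ → ∀ (a₀ θ₀ : T3 → ℝ) (u₀ : T3 → V3), Continuous a₀ → Continuous θ₀ →
        Continuous u₀ → (∀ x, 0 < a₀ x) → (∀ x, 0 < θ₀ x) → ∃ σ₀ : ℝ, 0 < σ₀ ∧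
          ∀ σ : ℝ, 0 < σ → σ < σ₀ → ∀ (T : ℝ) (ρ θ : ℝ → T3 → ℝ) (u : ℝ → T3 → V3),
            IsHardSphereEulerSolution σ T ρ u θ →
              (∀ Φ : Flows σ, TendstoHydroFieldsAt (fun N => localGibbsLaw σ a₀ u₀ θ₀ N (Φ N)) Φ ρ u θ 0) →
              ∀ t ∈ Ico 0 T, ∀ x, ρ t x < σ ^ (-κ) := by
  unfold PolynomialCompression
  push Not
  rfl

/-- **A disproof of the crux PROVES `DiluteSelfConsistency`** (rank-3 crux stmt-3091, shared by 13 routes,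
difficulty "open-problem"; the conclusion below is that decl UNFOLDED VERBATIM): `¬PolynomialCompression` at `κ = 1`
bounds the packing by `ρσ³ < σ² < η` for `σ < min(σ₀, 1, η)`; the one-flow tie is upgraded to all flows by
flow-independence. So no refutation of the crux is cheaper than the open positive crux. [folklore] -/
theorem packingBound_of_not_polynomialCompression (h : ¬ PolynomialCompression) :
    ∀ η : ℝ, 0 < η → ∀ (a₀ θ₀ : T3 → ℝ) (u₀ : T3 → V3), Continuous a₀ → Continuous θ₀ → Continuous u₀ →
      (∀ x, 0 < a₀ x) → (∀ x, 0 < θ₀ x) → ∃ σ₀ : ℝ, 0 < σ₀ ∧ ∀ σ : ℝ, 0 < σ → σ < σ₀ →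
        ∀ (T : ℝ) (ρ θ : ℝ → T3 → ℝ) (u : ℝ → T3 → V3), IsHardSphereEulerSolution σ T ρ u θ →
          ∀ Φ : Flows σ, TendstoHydroFieldsAt (fun N => localGibbsLaw σ a₀ u₀ θ₀ N (Φ N)) Φ ρ u θ 0 →
            ∀ t ∈ Ico 0 T, ∀ x, ρ t x * σ ^ 3 < η := by
  rw [not_polynomialCompression_iff] at h
  intro η hη a₀ θ₀ u₀ ha hθ hu ha0 hθ0
  obtain ⟨σ₀, hσ₀, H⟩ := h 1 one_pos a₀ θ₀ u₀ ha hθ hu ha0 hθ0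
  refine ⟨min σ₀ (min 1 η), lt_min hσ₀ (lt_min one_pos hη), fun σ hσ hσlt T ρ θ u hE Φ h0 t ht x => ?_⟩
  have hσ₀' : σ < σ₀ := lt_of_lt_of_le hσlt (min_le_left _ _)
  have hσ1 : σ < 1 := lt_of_lt_of_le hσlt ((min_le_right _ _).trans (min_le_left _ _))
  have hση : σ < η := lt_of_lt_of_le hσlt ((min_le_right _ _).trans (min_le_right _ _))
  have hlt := H σ hσ hσ₀' T ρ θ u hE (fun Ψ => tendstoHydroFieldsAt_zero_of_one_flow Φ Ψ h0) t ht x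
  rw [Real.rpow_neg hσ.le, Real.rpow_one] at hlt
  have hσ3 : 0 < σ ^ 3 := pow_pos hσ 3
  calc ρ t x * σ ^ 3 < σ⁻¹ * σ ^ 3 := mul_lt_mul_of_pos_right hlt hσ3
    _ = σ ^ 2 := by field_simp
    _ < η := by nlinarith

/-- Sanity check (definitional): the packing bound above IS `DiluteSelfConsistency`. [folklore] -/
example (h : ¬ PolynomialCompression) : DiluteSelfConsistency :=
  packingBound_of_not_polynomialCompression h

end Summit.AtomisticToContinuum.HydrodynamicLimit.Theorems

end
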